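import Literature.MathematicalPhysics.QuantumFieldTheory.Balaban1983to89.B9Eq324NearFlatFormComparisonZd

/-!
# `Balaban1983to89.B9Eq324NearFlatFormComparisonZdTowerPairs` — [Balaban1985BackgroundPropagators] (3.18)–(3.19) p. 393, (3.23)–(3.24) p. 394, Thm 3.11 p. 416 with
# [Balaban1985Averaging] (122)–(126) p. 36: the near-flat form comparison of `B9Eq324NearFlatFormComparisonZd` with the averaged-transporter closeness displayed ONLY on
# the tower pairs `Ū₀ⁱ(Γ_{blockMap L w, w})` that (3.19) actually uses — the DISCHARGEABLE edition (dag-n05-w3's `B8Ineq159TowerNearFlat.norm_bgT_sub_one_le` bounds exactly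
# these transporters near the flat background)

statement-level skeleton of published theorems with citation tags; proofs where landed; nothing here is a claim about the
Yang–Mills mass gap

`[Balaban1985BackgroundPropagators]` ("B9", CMP **99** (1985) 389–434) (3.18)–(3.19) p. 393 (`Q′_j(U) = Q′(Ūʲ⁻¹)⋯Q′(U)`: the fibre transport climbs the block tower through the
ONE-STEP contours `Γ_{y_{i+1}, y_i}`, `y_i = blockMap^[i] x`), (3.23)–(3.24) p. 394, Thm 3.11 p. 416; `[Balaban1985Averaging]` (42)–(43) pp. 23–24, (122)–(126) p. 36.
PDF held: `paper:balaban1985-cmp99-background-propagators` pp. 393–394 (re-read 2026-08-28).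

CITATION HEADER (lean-in-tree rule).  Cell `pub-ymgap` (YM Track A, D-0062 ∕ D-0149), node N06 = [B9], width seat `pub-ymgap-dag-n06-w4` (g5), CLAIM-6b — companion of the landed
`B9Eq324NearFlatFormComparisonZd` (p636054), whose `hTε` quantifies over ALL pairs `(z, y)`: too strong to discharge (far pairs carry long contours).  Same proofs, weaker
hypothesis.  Inputs BY NAME: that file (`fnorm_sq_le_two_mul_add`, `QprimeIter_eq_blockSum_trIter`, `gradEnergy_one_le`), g2 `B9Eq325QprimeSingleSiteZd` (`trIter`,
`blockMapIter`), dag-n06-w2's `B9Eq342CombesThomasFormZd` ∕ `B9Thm31GpDecayOfCoerciveZd` (`fnorm…`), g4 `B9Eq324DeltaPrimeUpperBoundZd.sum_fnorm_sq_le_formE`,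
g2 `B9Eq324DeltaPrimeAZd.formE_deltaPrimeADom`, dag-n05's `B8Eq191FlatStencils.conjR_unitOne`.

WHAT IS PROVED (kernel, 0 sorry; theorems only): ★ `fnorm_trIter_sub_flat_le'`, ★★ `fnorm_QprimeIter_sub_one_sq_le'`, ★★ `penalty_one_le'`, ★★★ `formE_deltaPrimeADom_one_le_near_flat'`,
★★★ `coercive_of_flat_coercive_near_flat'` — the statements of the unprimed theorems with `hTε : ∀ i < m, ∀ w b, |R(Ū₀ⁱ(Γ_{blockMap L w, w}))b − b|_τ ≤ ε_i|b|_τ`.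

HONEST SCOPE.  As the companion: hypotheses DISPLAYED in the `τ`-size at scale `η`; constants explicit, scale-free; `L²_τ` currency, no decay; count-neutral helper (`--supports`
the K1 item of record); N05 ∕ N06 NOT discharged; K1 NOT closed; one finite `𝕋⁴` programme at fixed `ε`, Bałaban as printed; R4 closes only the conditional finite-`𝕋⁴` rung
`BalabanLadder.UV` — nothing continuum ∕ ℝ⁴ ∕ OS ∕ mass gap ∕ Clay.  Unit `pub-ymgap-dag-n06-w4` (g5), 2026-08-28.
-/

noncomputable section

namespace Literature.MathematicalPhysics.QuantumFieldTheory.Balaban1983to89.B9Eq324NearFlatFormComparisonZdTowerPairs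

open B7Prop1Explicit
open B7Eq78Linearization (conjR conjR_apply conjR_sub conjR_smul_real QprimeIter zdBlocking)
open B7Prop2Explicit (unitaryUnits)
open B8Ineq132 (covDerivFwd)
open B8Eq119TwistedAxial (bgT bgT_one)
open Literature.MathematicalPhysics.QuantumLattice (blockMap blockSites mem_blockSites_iff card_blockSites)
open B9Eq321LandauProjectionZd (suppSub formE formE_apply)
open B9Eq324DeltaPrimeAZd (deltaPrimeADom formE_deltaPrimeADom)
open B9Eq325QprimeSingleSiteZd (blockMapIter blockMapIter_eq_blockMap_pow trIter trIter_zero trIter_succ)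
open B9Eq342CombesThomasFormZd (fnorm fnorm_nonneg fnorm_sq fnorm_smul fnorm_zero fnorm_add_le fnorm_sum_le formE_self_nonneg')
open B9Thm31GpDecayOfCoerciveZd (fnorm_conjR_of_unitary fnorm_neg')
open B9Eq324DeltaPrimeUpperBoundZd (sum_fnorm_sq_le_formE)
open B8Eq191FlatStencils (conjR_unitOne)
open B9Eq324NearFlatFormComparisonZd (fnorm_sq_le_two_mul_add QprimeIter_eq_blockSum_trIter gradEnergy_one_le)

-- `Site` alone could resolve to the torus sites of `Setup.lean`; re-export the `ℤ^d` sites of `B7Prop1Explicit`.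
export B7Prop1Explicit (Site)

variable {d : ℕ} {𝔸 : Type*} [CStarAlgebra 𝔸]
variable (τ : 𝔸 →ₗ[ℂ] ℂ) (hτp : ∀ a : 𝔸, a ≠ 0 → 0 < (τ (star a * a)).re)
  (hτt : ∀ a b : 𝔸, τ (a * b) = τ (b * a)) (hτs : ∀ a : 𝔸, τ (star a) = starRingEnd ℂ (τ a))

/-! ## §1  The transport ∕ averaging defects and the penalty comparison with tower-pair closeness -/

section TowerPairs

variable {L : ℕ} {U₀ : Site d → Fin d → 𝔸ˣ}

include hτp hτt hτs in
/-- ★ `fnorm_trIter_sub_flat_le` with closeness asked only of the tower transporters `Ū₀ⁱ(Γ_{blockMap L w, w})`.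
[cite: Balaban1985BackgroundPropagators, (3.18)–(3.19) p.393; Balaban1985Averaging, (122)–(126) p.36] -/
theorem fnorm_trIter_sub_flat_le' {ε : ℕ → ℝ} (x : Site d) (a : 𝔸) :
    ∀ j : ℕ, (∀ i, i < j → ∀ z y : Site d, bgT L U₀ i z y ∈ unitaryUnits 𝔸) →
      (∀ i, i < j → ∀ (w : Site d) (b : 𝔸), fnorm τ (conjR (bgT L U₀ i (blockMap L w) w) b - b) ≤ ε i * fnorm τ b) →
        fnorm τ (trIter L U₀ j x a - (((L : ℝ) ^ d)⁻¹) ^ j • a) ≤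
          (((L : ℝ) ^ d)⁻¹) ^ j * (∑ i ∈ Finset.range j, ε i) * fnorm τ a := by
  intro j
  induction j with
  | zero =>
    intro _ _
    rw [trIter_zero, pow_zero, one_smul, sub_self, fnorm_zero, Finset.range_zero, Finset.sum_empty, mul_zero, zero_mul]
  | succ j ih =>
    intro hT hTε
    have hc0 : (0 : ℝ) ≤ ((L : ℝ) ^ d)⁻¹ := by positivity
    set c : ℝ := ((L : ℝ) ^ d)⁻¹ with hc
    set T := bgT L U₀ j (blockMapIter L (j + 1) x) (blockMapIter L j x) with hTdef
    have hTw : T = bgT L U₀ j (blockMap L (blockMapIter L j x)) (blockMapIter L j x) := by rw [hTdef]; rfl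
    have ih' := ih (fun i hi => hT i (Nat.lt_succ_of_lt hi)) (fun i hi => hTε i (Nat.lt_succ_of_lt hi))
    have hsplit : trIter L U₀ (j + 1) x a - c ^ (j + 1) • a =
        c • conjR T (trIter L U₀ j x a - c ^ j • a) + c ^ (j + 1) • (conjR T a - a) := by
      rw [trIter_succ, ← hTdef, ← hc, conjR_sub, conjR_smul_real, smul_sub, smul_sub, smul_smul, ← pow_succ']
      abel
    rw [hsplit]
    have hdef : fnorm τ (conjR T a - a) ≤ ε j * fnorm τ a := by rw [hTw]; exact hTε j (Nat.lt_succ_self j) _ a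
    calc fnorm τ (c • conjR T (trIter L U₀ j x a - c ^ j • a) + c ^ (j + 1) • (conjR T a - a))
        ≤ fnorm τ (c • conjR T (trIter L U₀ j x a - c ^ j • a)) + fnorm τ (c ^ (j + 1) • (conjR T a - a)) := fnorm_add_le hτp hτs _ _
      _ = c * fnorm τ (trIter L U₀ j x a - c ^ j • a) + c ^ (j + 1) * fnorm τ (conjR T a - a) := by
          rw [fnorm_smul, fnorm_smul, fnorm_conjR_of_unitary τ hτt (hT j (Nat.lt_succ_self j) _ _), abs_of_nonneg hc0,
            abs_of_nonneg (pow_nonneg hc0 _)]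
      _ ≤ c * (c ^ j * (∑ i ∈ Finset.range j, ε i) * fnorm τ a) + c ^ (j + 1) * (ε j * fnorm τ a) :=
          add_le_add (mul_le_mul_of_nonneg_left ih' hc0) (mul_le_mul_of_nonneg_left hdef (pow_nonneg hc0 _))
      _ = c ^ (j + 1) * (∑ i ∈ Finset.range (j + 1), ε i) * fnorm τ a := by
          rw [Finset.sum_range_succ, pow_succ]
          ring

variable [NeZero L] {s : Finset (Site d)}

include hτp hτt hτs in
/-- ★★ `fnorm_QprimeIter_sub_one_sq_le` with tower-pair closeness. [cite: Balaban1985BackgroundPropagators, (3.18)–(3.19) p.393, (3.24) p.394; Balaban1985Averaging, (122)–(126) p.36] -/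
theorem fnorm_QprimeIter_sub_one_sq_le' {ε : ℕ → ℝ} (hε : ∀ i, 0 ≤ ε i) (f : suppSub (𝔸 := 𝔸) s) {j : ℕ}
    (hT : ∀ i, i < j → ∀ z y : Site d, bgT L U₀ i z y ∈ unitaryUnits 𝔸)
    (hTε : ∀ i, i < j → ∀ (w : Site d) (b : 𝔸), fnorm τ (conjR (bgT L U₀ i (blockMap L w) w) b - b) ≤ ε i * fnorm τ b) (y : Site d) :
    fnorm τ (QprimeIter (zdBlocking d L) (bgT L U₀) j (f : Site d → 𝔸) y -
        QprimeIter (zdBlocking d L) (bgT L (1 : Site d → Fin d → 𝔸ˣ)) j (f : Site d → 𝔸) y) ^ 2 ≤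
      (((L : ℝ) ^ d) ^ j)⁻¹ * (∑ i ∈ Finset.range j, ε i) ^ 2 * ∑ x ∈ blockSites (L ^ j) y, fnorm τ ((f : Site d → 𝔸) x) ^ 2 := by
  classical
  set B := blockSites (L ^ j) y with hB
  set c : ℝ := ((L : ℝ) ^ d)⁻¹ with hc
  set E : ℝ := ∑ i ∈ Finset.range j, ε i with hE
  have hc0 : 0 ≤ c := by positivity
  have hE0 : 0 ≤ E := Finset.sum_nonneg fun i _ => hε i
  have hL0 : (0 : ℝ) < (L : ℝ) := by exact_mod_cast Nat.pos_of_ne_zero (NeZero.ne L)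
  have hflat : ∀ x : Site d, trIter L (1 : Site d → Fin d → 𝔸ˣ) j x ((f : Site d → 𝔸) x) = c ^ j • (f : Site d → 𝔸) x := by
    intro x
    have h : ∀ i : ℕ, trIter L (1 : Site d → Fin d → 𝔸ˣ) i x ((f : Site d → 𝔸) x) = c ^ i • (f : Site d → 𝔸) x := by
      intro i
      induction i with
      | zero => rw [trIter_zero, pow_zero, one_smul]
      | succ i ih => rw [trIter_succ, ih, bgT_one, conjR_unitOne, smul_smul, hc, pow_succ, mul_comm]
    exact h j
  have hdiff : QprimeIter (zdBlocking d L) (bgT L U₀) j (f : Site d → 𝔸) y -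
      QprimeIter (zdBlocking d L) (bgT L (1 : Site d → Fin d → 𝔸ˣ)) j (f : Site d → 𝔸) y =
        ∑ x ∈ B, (trIter L U₀ j x ((f : Site d → 𝔸) x) - c ^ j • (f : Site d → 𝔸) x) := by
    rw [QprimeIter_eq_blockSum_trIter U₀ f j y, QprimeIter_eq_blockSum_trIter (1 : Site d → Fin d → 𝔸ˣ) f j y, ← hB, ← Finset.sum_sub_distrib]
    exact Finset.sum_congr rfl fun x _ => by rw [hflat x]
  have hpt : ∀ x ∈ B, fnorm τ (trIter L U₀ j x ((f : Site d → 𝔸) x) - c ^ j • (f : Site d → 𝔸) x) ≤ c ^ j * E * fnorm τ ((f : Site d → 𝔸) x) :=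
    fun x _ => fnorm_trIter_sub_flat_le' τ hτp hτt hτs x _ j hT hTε
  have h1 : fnorm τ (QprimeIter (zdBlocking d L) (bgT L U₀) j (f : Site d → 𝔸) y -
      QprimeIter (zdBlocking d L) (bgT L (1 : Site d → Fin d → 𝔸ˣ)) j (f : Site d → 𝔸) y) ≤ c ^ j * E * ∑ x ∈ B, fnorm τ ((f : Site d → 𝔸) x) := by
    rw [hdiff]
    refine (fnorm_sum_le hτp hτs _ _).trans ?_
    rw [Finset.mul_sum]
    exact Finset.sum_le_sum hpt
  have h0 : 0 ≤ fnorm τ (QprimeIter (zdBlocking d L) (bgT L U₀) j (f : Site d → 𝔸) y -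
      QprimeIter (zdBlocking d L) (bgT L (1 : Site d → Fin d → 𝔸ˣ)) j (f : Site d → 𝔸) y) := fnorm_nonneg τ _
  have hCS := sq_sum_le_card_mul_sum_sq (s := B) (f := fun x => fnorm τ ((f : Site d → 𝔸) x))
  rw [hB, card_blockSites] at hCS
  push_cast at hCS
  have hcard : (((L : ℝ) ^ j) ^ d) = ((L : ℝ) ^ d) ^ j := by rw [← pow_mul, ← pow_mul, mul_comm]
  rw [hcard] at hCS
  have hcj : c ^ j * ((L : ℝ) ^ d) ^ j = 1 := by
    rw [hc, inv_pow, inv_mul_cancel₀ (by positivity)]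
  calc fnorm τ _ ^ 2 ≤ (c ^ j * E * ∑ x ∈ B, fnorm τ ((f : Site d → 𝔸) x)) ^ 2 := pow_le_pow_left₀ h0 h1 2
    _ = (c ^ j) ^ 2 * E ^ 2 * (∑ x ∈ B, fnorm τ ((f : Site d → 𝔸) x)) ^ 2 := by ring
    _ ≤ (c ^ j) ^ 2 * E ^ 2 * (((L : ℝ) ^ d) ^ j * ∑ x ∈ B, fnorm τ ((f : Site d → 𝔸) x) ^ 2) :=
        mul_le_mul_of_nonneg_left (by rw [hB]; exact hCS) (by positivity)
    _ = (((L : ℝ) ^ d) ^ j)⁻¹ * E ^ 2 * ∑ x ∈ B, fnorm τ ((f : Site d → 𝔸) x) ^ 2 := by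
        have : (c ^ j) ^ 2 * ((L : ℝ) ^ d) ^ j = (((L : ℝ) ^ d) ^ j)⁻¹ := by
          rw [sq, mul_assoc, hcj, mul_one, hc, inv_pow]
        rw [← this, hB]
        ring

include hτp hτt hτs in
/-- ★★ `penalty_one_le` with tower-pair closeness. [cite: Balaban1985BackgroundPropagators, (3.18)–(3.19) p.393, (3.23)–(3.24) p.394; Balaban1985Averaging, (122)–(126) p.36] -/
theorem penalty_one_le' (m : ℕ) {a : ℕ → ℝ} (ha : ∀ j, 0 ≤ a j) (Λ : ℕ → Finset (Site d))
    (hdisj : ∀ j ∈ Finset.range (m + 1), ∀ y ∈ Λ j, ∀ i ∈ Finset.range (m + 1), ∀ y' ∈ Λ i, (i, y') ≠ (j, y) →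
      ∀ x : Site d, blockMapIter L j x = y → blockMapIter L i x ≠ y')
    {ε : ℕ → ℝ} (hε : ∀ i, 0 ≤ ε i) (hT : ∀ i, i < m → ∀ z y : Site d, bgT L U₀ i z y ∈ unitaryUnits 𝔸)
    (hTε : ∀ i, i < m → ∀ (w : Site d) (b : 𝔸), fnorm τ (conjR (bgT L U₀ i (blockMap L w) w) b - b) ≤ ε i * fnorm τ b)
    {κ : ℝ} (hκ0 : 0 ≤ κ) (hκ : ∀ j ∈ Finset.range (m + 1), a j * ((((L : ℝ) ^ d) ^ j)⁻¹ * (∑ i ∈ Finset.range j, ε i) ^ 2) ≤ κ)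
    (f : suppSub (𝔸 := 𝔸) s) :
    ∑ j ∈ Finset.range (m + 1), a j * ∑ y ∈ Λ j,
        fnorm τ (QprimeIter (zdBlocking d L) (bgT L (1 : Site d → Fin d → 𝔸ˣ)) j (f : Site d → 𝔸) y) ^ 2 ≤
      2 * ∑ j ∈ Finset.range (m + 1), a j * ∑ y ∈ Λ j, fnorm τ (QprimeIter (zdBlocking d L) (bgT L U₀) j (f : Site d → 𝔸) y) ^ 2 +
        2 * κ * formE τ s f f := by
  classical
  set F : Site d → 𝔸 := (f : Site d → 𝔸) with hF
  let blk : ℕ × Site d → Finset (Site d) := fun p => blockSites (L ^ p.1) p.2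
  have hpt : ∀ j ∈ Finset.range (m + 1), ∀ y ∈ Λ j,
      a j * fnorm τ (QprimeIter (zdBlocking d L) (bgT L (1 : Site d → Fin d → 𝔸ˣ)) j F y) ^ 2 ≤
        2 * (a j * fnorm τ (QprimeIter (zdBlocking d L) (bgT L U₀) j F y) ^ 2) + 2 * κ * ∑ x ∈ blk (j, y), fnorm τ (F x) ^ 2 := by
    intro j hj y _
    have hjm : j ≤ m := Nat.lt_succ_iff.1 (Finset.mem_range.1 hj)
    have h1 := fnorm_sq_le_two_mul_add τ hτp hτs (QprimeIter (zdBlocking d L) (bgT L (1 : Site d → Fin d → 𝔸ˣ)) j F y)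
      (QprimeIter (zdBlocking d L) (bgT L U₀) j F y)
    have h2 := fnorm_QprimeIter_sub_one_sq_le' τ hτp hτt hτs hε f (j := j) (fun i hi => hT i (lt_of_lt_of_le hi hjm))
      (fun i hi => hTε i (lt_of_lt_of_le hi hjm)) y
    rw [← neg_sub, fnorm_neg'] at h1
    have hS : 0 ≤ ∑ x ∈ blk (j, y), fnorm τ (F x) ^ 2 := Finset.sum_nonneg fun _ _ => sq_nonneg _
    have h3 : a j * fnorm τ (QprimeIter (zdBlocking d L) (bgT L U₀) j F y -
        QprimeIter (zdBlocking d L) (bgT L (1 : Site d → Fin d → 𝔸ˣ)) j F y) ^ 2 ≤ κ * ∑ x ∈ blk (j, y), fnorm τ (F x) ^ 2 := by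
      calc a j * fnorm τ _ ^ 2 ≤ a j * ((((L : ℝ) ^ d) ^ j)⁻¹ * (∑ i ∈ Finset.range j, ε i) ^ 2 * ∑ x ∈ blk (j, y), fnorm τ (F x) ^ 2) :=
            mul_le_mul_of_nonneg_left h2 (ha j)
        _ = a j * ((((L : ℝ) ^ d) ^ j)⁻¹ * (∑ i ∈ Finset.range j, ε i) ^ 2) * ∑ x ∈ blk (j, y), fnorm τ (F x) ^ 2 := by ring
        _ ≤ κ * ∑ x ∈ blk (j, y), fnorm τ (F x) ^ 2 := mul_le_mul_of_nonneg_right (hκ j hj) hS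
    nlinarith [mul_le_mul_of_nonneg_left h1 (ha j), h3, ha j]
  set B : Finset (ℕ × Site d) := (Finset.range (m + 1)).biUnion fun j => (Λ j).image (Prod.mk j) with hB
  have hmemB : ∀ p : ℕ × Site d, p ∈ B ↔ p.1 ∈ Finset.range (m + 1) ∧ p.2 ∈ Λ p.1 := by
    intro p
    simp only [hB, Finset.mem_biUnion, Finset.mem_image]
    constructor
    · rintro ⟨j, hj, y, hy, rfl⟩
      exact ⟨hj, hy⟩
    · rintro ⟨hj, hy⟩
      exact ⟨p.1, hj, p.2, hy, rfl⟩
  have hdisjB : (↑(Finset.range (m + 1)) : Set ℕ).PairwiseDisjoint (fun j => (Λ j).image (Prod.mk j)) := by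
    intro j₁ _ j₂ _ hne
    rw [Function.onFun, Finset.disjoint_left]
    intro p hp₁ hp₂
    rw [Finset.mem_image] at hp₁ hp₂
    obtain ⟨y₁, _, rfl⟩ := hp₁
    obtain ⟨y₂, _, h2⟩ := hp₂
    exact hne (Prod.ext_iff.1 h2).1.symm
  have hlevel : ∀ G : ℕ × Site d → ℝ, ∑ j ∈ Finset.range (m + 1), ∑ y ∈ Λ j, G (j, y) = ∑ p ∈ B, G p := by
    intro G
    rw [hB, Finset.sum_biUnion hdisjB]
    refine Finset.sum_congr rfl fun j _ => ?_
    rw [Finset.sum_image fun y _ y' _ h' => (Prod.ext_iff.1 h').2]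
  have hblk : ∀ (p : ℕ × Site d) (x : Site d), x ∈ blk p ↔ blockMapIter L p.1 x = p.2 := fun p x => by
    haveI : NeZero (L ^ p.1) := ⟨pow_ne_zero p.1 (NeZero.ne L)⟩
    show x ∈ blockSites (L ^ p.1) p.2 ↔ _
    rw [mem_blockSites_iff, blockMapIter_eq_blockMap_pow]
  have hdisjblk : (↑B : Set (ℕ × Site d)).PairwiseDisjoint blk := by
    intro p hp q hq hne
    rw [Finset.mem_coe, hmemB] at hp hq
    rw [Function.onFun, Finset.disjoint_left]
    intro x hxp hxq
    rw [hblk] at hxp hxq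
    have hne' : (q.1, q.2) ≠ (p.1, p.2) := fun h' => hne (Prod.ext (Prod.ext_iff.1 h').1.symm (Prod.ext_iff.1 h').2.symm)
    exact hdisj p.1 hp.1 p.2 hp.2 q.1 hq.1 q.2 hq.2 hne' x hxp hxq
  have hcover : ∑ p ∈ B, ∑ x ∈ blk p, fnorm τ (F x) ^ 2 ≤ formE τ s f f := by
    rw [← Finset.sum_biUnion hdisjblk]
    exact sum_fnorm_sq_le_formE τ hτp f _
  calc ∑ j ∈ Finset.range (m + 1), a j * ∑ y ∈ Λ j, fnorm τ (QprimeIter (zdBlocking d L) (bgT L (1 : Site d → Fin d → 𝔸ˣ)) j F y) ^ 2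
      = ∑ j ∈ Finset.range (m + 1), ∑ y ∈ Λ j, a j * fnorm τ (QprimeIter (zdBlocking d L) (bgT L (1 : Site d → Fin d → 𝔸ˣ)) j F y) ^ 2 :=
        Finset.sum_congr rfl fun j _ => Finset.mul_sum _ _ _
    _ ≤ ∑ j ∈ Finset.range (m + 1), ∑ y ∈ Λ j,
          (2 * (a j * fnorm τ (QprimeIter (zdBlocking d L) (bgT L U₀) j F y) ^ 2) + 2 * κ * ∑ x ∈ blk (j, y), fnorm τ (F x) ^ 2) :=
        Finset.sum_le_sum fun j hj => Finset.sum_le_sum fun y hy => hpt j hj y hy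
    _ = 2 * ∑ j ∈ Finset.range (m + 1), a j * ∑ y ∈ Λ j, fnorm τ (QprimeIter (zdBlocking d L) (bgT L U₀) j F y) ^ 2 +
          2 * κ * ∑ p ∈ B, ∑ x ∈ blk p, fnorm τ (F x) ^ 2 := by
        rw [← hlevel (fun p => ∑ x ∈ blk p, fnorm τ (F x) ^ 2)]
        simp only [Finset.sum_add_distrib, Finset.mul_sum]
    _ ≤ 2 * ∑ j ∈ Finset.range (m + 1), a j * ∑ y ∈ Λ j, fnorm τ (QprimeIter (zdBlocking d L) (bgT L U₀) j F y) ^ 2 +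
          2 * κ * formE τ s f f := by
        have h2κ : 0 ≤ 2 * κ := by positivity
        linarith [mul_le_mul_of_nonneg_left hcover h2κ]

end TowerPairs

/-! ## §2  Assembly and transfer of coercivity -/

section AssemblyTowerPairs

variable [FiniteDimensional ℝ 𝔸] {L : ℕ} [NeZero L] {η : ℝ} {U₀ : Site d → Fin d → 𝔸ˣ} {θ : ℝ}

include hτt hτs in
/-- ★★★ `formE_deltaPrimeADom_one_le_near_flat` with tower-pair closeness (the dischargeable edition).
[cite: Balaban1985BackgroundPropagators, (3.23)–(3.24) p.394, (3.86) p.407, Thm 3.11 p.416; Balaban1985Averaging, (122)–(126) p.36] -/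
theorem formE_deltaPrimeADom_one_le_near_flat' (hη : 0 < η) (hU : ∀ (x : Site d) (κ' : Fin d), U₀ x κ' ∈ unitaryUnits 𝔸)
    (hR : ∀ (x : Site d) (μ : Fin d) (b : 𝔸), fnorm τ (conjR (U₀ x μ) b - b) ≤ θ * η * fnorm τ b)
    (m : ℕ) {a : ℕ → ℝ} (ha : ∀ j, 0 ≤ a j) (Λ : ℕ → Finset (Site d)) {s : Finset (Site d)}
    (hdisj : ∀ j ∈ Finset.range (m + 1), ∀ y ∈ Λ j, ∀ i ∈ Finset.range (m + 1), ∀ y' ∈ Λ i, (i, y') ≠ (j, y) →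
      ∀ x : Site d, blockMapIter L j x = y → blockMapIter L i x ≠ y')
    {ε : ℕ → ℝ} (hε : ∀ i, 0 ≤ ε i) (hT : ∀ i, i < m → ∀ z y : Site d, bgT L U₀ i z y ∈ unitaryUnits 𝔸)
    (hTε : ∀ i, i < m → ∀ (w : Site d) (b : 𝔸), fnorm τ (conjR (bgT L U₀ i (blockMap L w) w) b - b) ≤ ε i * fnorm τ b)
    {κ : ℝ} (hκ0 : 0 ≤ κ) (hκ : ∀ j ∈ Finset.range (m + 1), a j * ((((L : ℝ) ^ d) ^ j)⁻¹ * (∑ i ∈ Finset.range j, ε i) ^ 2) ≤ κ)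
    (f : suppSub (𝔸 := 𝔸) s) :
    formE τ s f (deltaPrimeADom L (1 : Site d → Fin d → 𝔸ˣ) η τ hτp m a Λ s f) ≤
      2 * formE τ s f (deltaPrimeADom L U₀ η τ hτp m a Λ s f) + 2 * (d * θ ^ 2 + κ) * formE τ s f f := by
  have hone : ∀ (x : Site d) (κ' : Fin d), (1 : Site d → Fin d → 𝔸ˣ) x κ' ∈ unitaryUnits 𝔸 := fun _ _ => (unitaryUnits 𝔸).one_mem
  have hsq : ∀ (V : Site d → Fin d → 𝔸ˣ) (hV : ∀ (x : Site d) (κ' : Fin d), V x κ' ∈ unitaryUnits 𝔸),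
      formE τ s f (deltaPrimeADom L V η τ hτp m a Λ s f) =
        (∑ μ : Fin d, ∑ᶠ x, fnorm τ (covDerivFwd η V μ (f : Site d → 𝔸) x) ^ 2) +
          ∑ j ∈ Finset.range (m + 1), a j * ∑ y ∈ Λ j, fnorm τ (QprimeIter (zdBlocking d L) (bgT L V) j (f : Site d → 𝔸) y) ^ 2 := by
    intro V hV
    rw [formE_deltaPrimeADom (L := L) (m := m) (a := a) (Λ := Λ) τ hτp hτt hτs hV f f]
    congr 1
    · exact Finset.sum_congr rfl fun μ _ => finsum_congr fun x => (fnorm_sq hτp _).symm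
    · exact Finset.sum_congr rfl fun j _ => by rw [Finset.sum_congr rfl fun y _ => (fnorm_sq hτp _).symm]
  rw [hsq 1 hone, hsq U₀ hU]
  have hG := gradEnergy_one_le τ hτp hτs hη hR f
  have hP := penalty_one_le' τ hτp hτt hτs m ha Λ hdisj hε hT hTε hκ0 hκ f
  nlinarith [hG, hP]

include hτt hτs in
/-- ★★★ `coercive_of_flat_coercive_near_flat` with tower-pair closeness (the dischargeable edition): a flat constant `a₀` transfers as `a₀∕2 − dθ² − κ`.
[cite: Balaban1985BackgroundPropagators, Thm 3.11 p.416, (3.86) p.407, Thm 3.1 p.397; Balaban1984PropagatorsII, (2.22) p.226] -/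
theorem coercive_of_flat_coercive_near_flat' (hη : 0 < η) (hU : ∀ (x : Site d) (κ' : Fin d), U₀ x κ' ∈ unitaryUnits 𝔸)
    (hR : ∀ (x : Site d) (μ : Fin d) (b : 𝔸), fnorm τ (conjR (U₀ x μ) b - b) ≤ θ * η * fnorm τ b)
    (m : ℕ) {a : ℕ → ℝ} (ha : ∀ j, 0 ≤ a j) (Λ : ℕ → Finset (Site d)) {s : Finset (Site d)}
    (hdisj : ∀ j ∈ Finset.range (m + 1), ∀ y ∈ Λ j, ∀ i ∈ Finset.range (m + 1), ∀ y' ∈ Λ i, (i, y') ≠ (j, y) →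
      ∀ x : Site d, blockMapIter L j x = y → blockMapIter L i x ≠ y')
    {ε : ℕ → ℝ} (hε : ∀ i, 0 ≤ ε i) (hT : ∀ i, i < m → ∀ z y : Site d, bgT L U₀ i z y ∈ unitaryUnits 𝔸)
    (hTε : ∀ i, i < m → ∀ (w : Site d) (b : 𝔸), fnorm τ (conjR (bgT L U₀ i (blockMap L w) w) b - b) ≤ ε i * fnorm τ b)
    {κ : ℝ} (hκ0 : 0 ≤ κ) (hκ : ∀ j ∈ Finset.range (m + 1), a j * ((((L : ℝ) ^ d) ^ j)⁻¹ * (∑ i ∈ Finset.range j, ε i) ^ 2) ≤ κ)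
    {a₀ : ℝ} (hflat : ∀ g : suppSub (𝔸 := 𝔸) s, a₀ * formE τ s g g ≤ formE τ s g (deltaPrimeADom L (1 : Site d → Fin d → 𝔸ˣ) η τ hτp m a Λ s g))
    (f : suppSub (𝔸 := 𝔸) s) :
    (a₀ / 2 - d * θ ^ 2 - κ) * formE τ s f f ≤ formE τ s f (deltaPrimeADom L U₀ η τ hτp m a Λ s f) := by
  have h1 := hflat f
  have h2 := formE_deltaPrimeADom_one_le_near_flat' τ hτp hτt hτs hη hU hR m ha Λ hdisj hε hT hTε hκ0 hκ f
  have h0 : 0 ≤ formE τ s f f := formE_self_nonneg' hτp f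
  nlinarith [h1, h2, h0]

end AssemblyTowerPairs

end Literature.MathematicalPhysics.QuantumFieldTheory.Balaban1983to89.B9Eq324NearFlatFormComparisonZdTowerPairs

end
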